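import Literature.Probability.RandomPlanarGeometry.RectangleModulusLambda
import HarnessLib

/-!
# The cross-ratio of the Schwarz–Christoffel prevertices is `λ` at the aspect ratio

Topic `Literature/Probability/RandomPlanarGeometry`. For `0 < k < 1` the Cardy cross-ratio of the
prevertices `(-1/k, -1, 1, 1/k)` of the rectangle map `F_k = scrFun k` onto
`(-K, K) × (0, K')` (`K = K(k²)`, `K' = K(1 - k²)`) equals the elliptic modular function at the
aspect ratio: `((1-k)/(1+k))² = λ(i · 2K/K')` (`crossRatio_scrPrevertex_eq_lamR`). This is the
pure special-function content of `rectangle_crossRatio_eq_lamR` (`RectangleModulusLambda.lean`,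
Kleban–Zagier (2003) §3; Bollobás–Riordan (2006) p. 185), extracted WITHOUT a rectangle structure:
choose `y > 0` with `λ(iy) = k²` (`exists_lamR_eq`: `λ(i·)` is continuous on `(0, ∞)` with
limits `1` at `0⁺` and `0` at `∞`), then Jacobi's inversion `K(1-k²) = y K(k²)`
(`ellipticK_one_sub_lamR`) and Landen's transformation `(1-k)/(1+k) = √λ(2i/y)`
(`one_sub_sqrt_lamR_div`). Everything is PROVED.

## References

* P. Kleban, D. Zagier, *Crossing probabilities and modular forms*, J. Stat. Phys. 113 (2003), §3.
* D. F. Lawden, *Elliptic Functions and Applications* (1989), §1.8, §2.2. [folklore]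
-/

noncomputable section

open Set Filter Topology

namespace Literature.Probability.RandomPlanarGeometry

open KlebanZagier Literature.Analysis.SpecialFunctions

/-- `λ(i·)` is continuous on `(0, ∞)`. [folklore] -/
theorem continuousOn_lamR : ContinuousOn lamR (Ioi 0) := fun _ ht =>
  (hasDerivAt_lamR ht).continuousAt.continuousWithinAt

/-- **`λ(i·)` takes every value in `(0, 1)` on `(0, ∞)`** (intermediate value theorem with the
limits `λ(iy) → 0` as `y → ∞` and `λ(i/y) = 1 - λ(iy) → 1`). [folklore] -/
theorem exists_lamR_eq {m : ℝ} (hm : m ∈ Ioo (0 : ℝ) 1) : ∃ y, 0 < y ∧ lamR y = m := by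
  -- a large parameter with `λ < m` and one with `λ < 1 - m`
  have h1 : ∀ᶠ t in atTop, lamR t < m := (tendsto_order.1 tendsto_lamR_atTop).2 m hm.1
  have h2 : ∀ᶠ t in atTop, lamR t < 1 - m :=
    (tendsto_order.1 tendsto_lamR_atTop).2 (1 - m) (by linarith [hm.2])
  obtain ⟨b, hb, hb1⟩ := (h1.and (eventually_ge_atTop 1)).exists
  obtain ⟨c, hc, hc1⟩ := (h2.and (eventually_ge_atTop 1)).exists
  have hb0 : 0 < b := by linarith
  have hc0 : 0 < c := by linarith
  set a := c⁻¹ with ha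
  have ha0 : 0 < a := inv_pos.2 hc0
  have hla : m < lamR a := by rw [ha, lamR_inv hc0]; linarith
  -- intermediate value theorem on `[a, b]` (unordered)
  have hcont : ContinuousOn lamR (uIcc a b) :=
    continuousOn_lamR.mono fun t ht => lt_of_lt_of_le (lt_min ha0 hb0) ht.1
  have hmem : m ∈ uIcc (lamR a) (lamR b) := by
    rw [uIcc_of_ge (by linarith)]
    exact ⟨hb.le, hla.le⟩
  obtain ⟨y, hy, hym⟩ := intermediate_value_uIcc hcont hmem
  exact ⟨y, lt_of_lt_of_le (lt_min ha0 hb0) hy.1, hym⟩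

/-- **The cross-ratio of `(-1/k, -1, 1, 1/k)` is `λ(i · 2K(k²)/K(1-k²))`.**
[cite: KlebanZagier2003, §3] -/
theorem crossRatio_scrPrevertex_eq_lamR {k : ℝ} (hk0 : 0 < k) (hk1 : k < 1) :
    crossRatio (scrPrevertex k) = lamR (2 * ellipticK (k ^ 2) / ellipticK (1 - k ^ 2)) := by
  obtain ⟨y, hy, hyk⟩ := exists_lamR_eq (m := k ^ 2) ⟨by positivity, by nlinarith⟩
  have hsq : Real.sqrt (lamR y) = k := by rw [hyk, Real.sqrt_sq hk0.le]
  have h1 := one_sub_sqrt_lamR_div hy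
  rw [hsq] at h1
  have hK : ellipticK (1 - k ^ 2) = y * ellipticK (k ^ 2) := by
    rw [← hyk]; exact ellipticK_one_sub_lamR hy
  have hKpos : 0 < ellipticK (k ^ 2) := ellipticK_sq_pos hk0 hk1
  have e : 2 * ellipticK (k ^ 2) / (y * ellipticK (k ^ 2)) = 2 * y⁻¹ := by
    field_simp
  rw [crossRatio_scrPrevertex hk0 hk1, hK, e, ← div_pow, h1,
    Real.sq_sqrt (lamR_mem_Ioo (by positivity)).1.le]

/-- The aspect ratio `K'/(2K)` (height over width of the rectangle `(-K,K) × (0,K')`) is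
positive and `((1-k)/(1+k))² = λ(i / (K'/(2K)))`. [folklore] -/
theorem crossRatio_scrPrevertex_eq_lamR_inv {k : ℝ} (hk0 : 0 < k) (hk1 : k < 1) :
    crossRatio (scrPrevertex k) = lamR (ellipticK (1 - k ^ 2) / (2 * ellipticK (k ^ 2)))⁻¹ := by
  rw [crossRatio_scrPrevertex_eq_lamR hk0 hk1, inv_div]

end Literature.Probability.RandomPlanarGeometry
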